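import Summits.QuantumFields.YangMills.Theorems.BalabanUVNodesPortS1Residue

/-!
# NODE O port PT-A — THE WRAP-AWARE RESIDUE (repair of RESIDUE-WRAP-DEFECT-v1): ONE integer formula `Ψ` for the domains OFF the wrap class `recordWrapCtr`, FREE torus-level
# pieces `Ew n X` ON it; the (S1) mould at 27930's names from it (`formatPlusG_recordJ_of_wrapAwareResidue`) and the SIGNED text ⁸-Ax-LR4 `12934e3fd231d69a` from it
# (`sig27930v8LR4_of_residueW`) — print's freedom restored: [I] (1.7) «depends on U_j restricted to X» (a wrapping X is read ON THE TORUS), (1.21) ties only non-wrapping pieces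

Cell `ym-nodeO-ideate`, porter seat `ymgap-nodeO-port-PTA-1` (gen 3); `--supports stmt-QuantumFields-27930` (helper — NOT a close).  [I] = [Balaban1987RG1].
WHY.  `…PortS1FlatBlind.represents_forces_flatBlind` (p801920): a residue whose pieces are pull-backs of ONE integer formula at EVERY domain is blind to the holonomy of flat
backgrounds — a constraint print does not impose and the record's functional (generically) violates; the wrapping domains (⊆ `recordWrapCtr`, the class meeting the antipodal
seam) must keep TORUS-LEVEL pieces.  The signed `FormatPlusG` already grants this (`PieceVolIndep` binds `X ∉ wrap n` only); gen 2's frame `formatPlusG_record_of_cpairRowsCtr`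
takes ARBITRARY pieces on pairs per volume — so the repair is a re-instantiation of the frame, nothing signed moves.
* §1 `not_onSeamCtr_liftCubeCtr`, ★ `recordDomEmbCtr_not_mem_recordWrapCtr` — OFF the wrap class the embedded domain is off the wrap class of the next volume (the centred lift keeps
  `valMinAbs`, the seam value does not decrease: `q_K ≤ q_{K+1}`), so row (e) reads the `Ψ` branch in BOTH volumes.
* §2 ★★★ `formatPlusG_recordJ_of_wrapAwareResidue` — TokP9-reg shape + `Ψ` ((LOC),(GI); (a)(b) asked only OFF the wrap class) + `Ew` ((a)(b)(c)(d) asked only ON it) + the wrap-aware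
  (f′) `Φf n B = Σ_X [X ∈ wrap ? Ew n X : Ψ-pull-back]((U_{k+1}(W_B), J(U_{k+1}(W_B))) cut to X)` ⟹ `B12FormatPlus.FormatPlusG` over the twelve record families.
* §3 ★★★ `sig27930v8LR4_of_residueW` — the signed text verbatim from its WRAP-AWARE residue form (the closing road, re-pointed).

HONEST FRAMING.  A re-instantiated reduction; the wrap-aware residue is NOT proved, NOT a fact; 27930 OPEN; K0⁷ NOT closed; NODE O 0∕1; COUNT 8∕28 · K 1∕4 UNMOVED; finite `𝕋⁴_{L^K}` at
fixed ε — NOT continuum ∕ OS ∕ Clay; **the Yang–Mills mass gap is NOT proved by any of this.**  No `sorry`, no `def`, no `instance`; standard axioms.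
-/

noncomputable section

open scoped BigOperators Matrix.Norms.L2Operator Topology

namespace Summit.QuantumFields.YangMills.Theorems.BalabanUVNodesPortS1

open Summit.QuantumFields.YangMills.Theorems.K0RecordFormatNames
open Literature.MathematicalPhysics.QuantumFieldTheory.Balaban1983to89
open Literature.MathematicalPhysics.QuantumFieldTheory.Balaban1983to89.Node00
open Literature.MathematicalPhysics.QuantumFieldTheory.Balaban1983to89.T4Continuum (T4Family)
open Literature.MathematicalPhysics.QuantumFieldTheory.Balaban1983to89.B15Eq112TorusCover (cover)
open Literature.MathematicalPhysics.QuantumFieldTheory.Balaban1983to89.B14.Eq213MaximalDomains (cubeExt)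
open Literature.MathematicalPhysics.QuantumFieldTheory.Balaban1983to89.TreeLengthTorus (TPt)
open _root_.Filter

variable (F : T4Family)

/-! ## §1  Off the wrap class, the embedded domain is off the wrap class of the next volume -/

variable {F} in
/-- A cube index off the seam of `T_K` lifts (centred) to a cube index off the seam of `T_{K+1}` (exactly tiled range): `valMinAbs` is kept (`valMinAbs_liftCubeCtr`), it is
`≤ ⌊q_K∕2⌋` and `≠ ⌊q_K∕2⌋`, hence `< ⌊q_K∕2⌋ ≤ ⌊q_{K+1}∕2⌋`. [cite: Balaban1987RG1, (1.21) p.264 (bookkeeping)] -/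
theorem not_onSeamCtr_liftCubeCtr {Mc k K : ℕ} (hMc : McGuard F Mc) (hK : recordK₀ F Mc k ≤ K)
    (c : TPt (F.P K).d (Sect2.domCount (F.P K) Mc (k + 1))) (hc : ¬ OnSeamCtr c) : ¬ OnSeamCtr (liftCubeCtr F Mc k K c) := by
  rintro ⟨i, hi⟩
  rw [valMinAbs_liftCubeCtr hMc hK c i] at hi
  have hle : ((c i).valMinAbs : ℤ) ≤ ((Sect2.domCount (F.P K) Mc (k + 1) / 2 : ℕ) : ℤ) := by
    have h := ZMod.natAbs_valMinAbs_le (c i)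
    have h' : ((c i).valMinAbs : ℤ) ≤ ((c i).valMinAbs.natAbs : ℤ) := Int.le_natAbs
    exact h'.trans (by exact_mod_cast h)
  have hne : ((c i).valMinAbs : ℤ) ≠ ((Sect2.domCount (F.P K) Mc (k + 1) / 2 : ℕ) : ℤ) := fun h => hc ⟨i, h⟩
  have hlt : ((c i).valMinAbs : ℤ) < ((Sect2.domCount (F.P K) Mc (k + 1) / 2 : ℕ) : ℤ) := lt_of_le_of_ne hle hne
  have hmono : ((Sect2.domCount (F.P K) Mc (k + 1) / 2 : ℕ) : ℤ) ≤ ((Sect2.domCount (F.P (K + 1)) Mc (k + 1) / 2 : ℕ) : ℤ) := by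
    exact_mod_cast Nat.div_le_div_right (domCount_le_succ hMc hK)
  have hd : (F.P (K + 1)).d = (F.P K).d := rfl
  omega

variable {F} in
/-- ★ **OFF THE WRAP CLASS, THE EMBEDDED DOMAIN IS OFF THE WRAP CLASS OF THE NEXT VOLUME** (exactly tiled range) — so the two-volume row (e) reads the integer-formula branch of a
wrap-aware piece family in BOTH volumes. [cite: Balaban1987RG1, (1.21) p.264, (1.7) p.261] -/
theorem recordDomEmbCtr_not_mem_recordWrapCtr {Mc k K : ℕ} (hMc : McGuard F Mc) (hK : recordK₀ F Mc k ≤ K)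
    (X : (recordDomSys F Mc k K).Dom) (hX : X ∉ recordWrapCtr F Mc k K) :
    recordDomEmbCtr F Mc k K X ∉ recordWrapCtr F Mc k (K + 1) := by
  classical
  intro hmem
  obtain ⟨c', hc', hs'⟩ := (mem_recordWrapCtr_iff F Mc k (K + 1) _).1 hmem
  rw [recordDomEmbCtr_val_of_not_mem F Mc k K X hX] at hc'
  obtain ⟨c, hc, rfl⟩ := Finset.mem_image.1 hc'
  exact not_onSeamCtr_liftCubeCtr hMc hK c (fun hs => hX ((mem_recordWrapCtr_iff F Mc k K X).2 ⟨c, hc, hs⟩)) hs'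

/-! ## §2  ★★★ The (S1) mould from the WRAP-AWARE residue -/

open scoped Classical in
/-- ★★★ **THE (S1) MOULD AT 27930's NAMES FROM THE WRAP-AWARE RESIDUE.**  Hypotheses: `hP9` — TokP9-reg shape at every volume; `Ψ` window-local (`hΨloc`) and `SL(2,ℂ)`-invariant (`hΨG`)
with (a) `hA` ∕ (b) `hB` for its pull-back pieces asked only at domains OFF the wrap class; torus-level pieces `Ew n X` with (a) `hEA`, (b) `hEB`, (c) `hEL` (locality on the sites of
`X`), (d) `hEG` (invariance under `recordGaugeGrp`) asked only ON the wrap class; (f′) `hR` — the wrap-aware pair identity for `Φf n` near `B = 0`.  Conclusion: `B12FormatPlus.FormatPlusG`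
over the twelve record families with `E₀, κ`.  The frame `formatPlusG_record_of_cpairRowsCtr` at the pieces `Ep n X := X ∈ recordWrapCtr ? Ew n X : Ψ-pull-back`; rows (c)(d)(e) for the
`Ψ` branch by `…PortS1LocalFormula`, (e) never reads the wrap class and §1 keeps the embedded domain off it; (f) from (f′) + the token (`…PortS1Selector` §3).
[cite: Balaban1987RG1, (1.6)–(1.9) p.261, (1.10) p.262, (1.18)–(1.19) p.263, (1.21) p.264; Balaban1985Variational, Prop. 9 p.309] -/
theorem formatPlusG_recordJ_of_wrapAwareResidue (Mc k : ℕ) (hMc : McGuard F Mc) (a₀ ε₂₉ α₀ α₁ E₀ κ : ℝ)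
    (Φf : (n : ℕ) → recordW F a₀ ε₂₉ k (recordK₀ F Mc k + n) → ℂ)
    (hP9 : ∀ n, letI θ := thetaFill F a₀ ε₂₉; letI := θ.instVβ₁; letI := θ.instVβ₂; letI := θ.instιβ
      AnalyticAt ℝ (fun B : recordW F a₀ ε₂₉ k (recordK₀ F Mc k + n) =>
        fun (b : PBond (F.P (recordK₀ F Mc k + n)) 0) (i i' : Fin 2) =>
          ((recordBgField F θ k (recordK₀ F Mc k + n) B b : SU 2) : Matrix (Fin 2) (Fin 2) ℂ) i i') 0)
    (Ψ : Finset (Fin 4 → ℤ) → (((Fin 4 → ℤ) × Fin 4) → MatA 2 × MatA 2) → ℂ)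
    (hΨloc : ∀ (Xh : Finset (Fin 4 → ℤ)) (f g : ((Fin 4 → ℤ) × Fin 4) → MatA 2 × MatA 2),
      (∀ zμ : (Fin 4 → ℤ) × Fin 4,
        zμ.1 ∈ (⋃ a ∈ Xh, cubeExt (F.L ^ (k + 1) * Mc) a 0) →
        Function.update zμ.1 zμ.2 (zμ.1 zμ.2 + 1) ∈ (⋃ a ∈ Xh, cubeExt (F.L ^ (k + 1) * Mc) a 0) → f zμ = g zμ) →
      Ψ Xh f = Ψ Xh g)
    (hΨG : ∀ (Xh : Finset (Fin 4 → ℤ)) (û : (Fin 4 → ℤ) → (MatA 2)ˣ),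
      (∀ z, û z ∈ (B12RegularSpaces111SpecialUnitary.suModel 2).Gc) →
      ∀ f : ((Fin 4 → ℤ) × Fin 4) → MatA 2 × MatA 2,
        Ψ Xh (fun zμ => ((û zμ.1 : MatA 2) * (f zμ).1 * ((û (Function.update zμ.1 zμ.2 (zμ.1 zμ.2 + 1)))⁻¹ : (MatA 2)ˣ),
          (û zμ.1 : MatA 2) * (f zμ).2 * ((û zμ.1)⁻¹ : (MatA 2)ˣ))) = Ψ Xh f)
    (Ew : (n : ℕ) → (recordDomSys F Mc k (recordK₀ F Mc k + n)).Dom → Sect2.CPair (F.P (recordK₀ F Mc k + n)) (MatA 2) → ℂ)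
    (hA : ∀ n (X : (recordDomSys F Mc k (recordK₀ F Mc k + n)).Dom) (φ : Sect2.CPair (F.P (recordK₀ F Mc k + n)) (MatA 2)),
      X ∉ recordWrapCtr F Mc k (recordK₀ F Mc k + n) →
      encodeCfg F (recordK₀ F Mc k + n) φ ∈ recordUc F Mc k α₀ α₁ (recordK₀ F Mc k + n) X →
        AnalyticAt ℂ (fun ψ : Sect2.CPair (F.P (recordK₀ F Mc k + n)) (MatA 2) =>
          Ψ ((X.1 : Finset _).image (fun c (i : Fin 4) => (c i).valMinAbs))
            (fun zμ => (ψ.1 ⟨cover (F.P (recordK₀ F Mc k + n)) zμ.1, zμ.2⟩, ψ.2 ⟨cover (F.P (recordK₀ F Mc k + n)) zμ.1, zμ.2⟩))) φ)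
    (hB : ∀ n (X : (recordDomSys F Mc k (recordK₀ F Mc k + n)).Dom) (φ : Sect2.CPair (F.P (recordK₀ F Mc k + n)) (MatA 2)),
      X ∉ recordWrapCtr F Mc k (recordK₀ F Mc k + n) →
      encodeCfg F (recordK₀ F Mc k + n) φ ∈ recordUc F Mc k α₀ α₁ (recordK₀ F Mc k + n) X →
        ‖Ψ ((X.1 : Finset _).image (fun c (i : Fin 4) => (c i).valMinAbs))
            (fun zμ => (φ.1 ⟨cover (F.P (recordK₀ F Mc k + n)) zμ.1, zμ.2⟩, φ.2 ⟨cover (F.P (recordK₀ F Mc k + n)) zμ.1, zμ.2⟩))‖ ≤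
          E₀ * Real.exp (-κ * (recordDomSys F Mc k (recordK₀ F Mc k + n)).dj X))
    (hEA : ∀ n (X : (recordDomSys F Mc k (recordK₀ F Mc k + n)).Dom) (φ : Sect2.CPair (F.P (recordK₀ F Mc k + n)) (MatA 2)),
      X ∈ recordWrapCtr F Mc k (recordK₀ F Mc k + n) →
      encodeCfg F (recordK₀ F Mc k + n) φ ∈ recordUc F Mc k α₀ α₁ (recordK₀ F Mc k + n) X → AnalyticAt ℂ (Ew n X) φ)
    (hEB : ∀ n (X : (recordDomSys F Mc k (recordK₀ F Mc k + n)).Dom) (φ : Sect2.CPair (F.P (recordK₀ F Mc k + n)) (MatA 2)),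
      X ∈ recordWrapCtr F Mc k (recordK₀ F Mc k + n) →
      encodeCfg F (recordK₀ F Mc k + n) φ ∈ recordUc F Mc k α₀ α₁ (recordK₀ F Mc k + n) X →
        ‖Ew n X φ‖ ≤ E₀ * Real.exp (-κ * (recordDomSys F Mc k (recordK₀ F Mc k + n)).dj X))
    (hEL : ∀ n (X : (recordDomSys F Mc k (recordK₀ F Mc k + n)).Dom), X ∈ recordWrapCtr F Mc k (recordK₀ F Mc k + n) →
      ∀ φ ψ, Sect2.agreeOnSet (Sect2.domSites (F.P (recordK₀ F Mc k + n)) Mc (k + 1) X) φ ψ → Ew n X φ = Ew n X ψ)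
    (hEG : ∀ n (X : (recordDomSys F Mc k (recordK₀ F Mc k + n)).Dom), X ∈ recordWrapCtr F Mc k (recordK₀ F Mc k + n) →
      ∀ (u : recordGaugeGrp F (recordK₀ F Mc k + n)) φ, Ew n X (Sect2.cAct u.1 φ) = Ew n X φ)
    (hR : ∀ n, letI θ := thetaFill F a₀ ε₂₉; letI := θ.instVβ₁; letI := θ.instVβ₂; letI := θ.instιβ
      ∀ᶠ B in 𝓝 (0 : recordW F a₀ ε₂₉ k (recordK₀ F Mc k + n)),
        Φf n B = ∑ X : (recordDomSys F Mc k (recordK₀ F Mc k + n)).Dom,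
          (if X ∈ recordWrapCtr F Mc k (recordK₀ F Mc k + n) then
            Ew n X (fun b => if b ∈ domBonds F Mc k (recordK₀ F Mc k + n) X then ((recordBgField F θ k (recordK₀ F Mc k + n) B b : SU 2) : MatA 2) else 1,
                    fun b => if b ∈ domBonds F Mc k (recordK₀ F Mc k + n) X then recordCurrent F θ k (recordK₀ F Mc k + n) B b else 0)
          else
            Ψ ((X.1 : Finset _).image (fun c (i : Fin 4) => (c i).valMinAbs))
              (fun zμ =>
                ((if (⟨cover (F.P (recordK₀ F Mc k + n)) zμ.1, zμ.2⟩ : PBond (F.P (recordK₀ F Mc k + n)) 0) ∈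
                      domBonds F Mc k (recordK₀ F Mc k + n) X then
                    ((recordBgField F θ k (recordK₀ F Mc k + n) B ⟨cover (F.P (recordK₀ F Mc k + n)) zμ.1, zμ.2⟩ : SU 2) : MatA 2) else 1),
                 (if (⟨cover (F.P (recordK₀ F Mc k + n)) zμ.1, zμ.2⟩ : PBond (F.P (recordK₀ F Mc k + n)) 0) ∈
                      domBonds F Mc k (recordK₀ F Mc k + n) X then
                    recordCurrent F θ k (recordK₀ F Mc k + n) B ⟨cover (F.P (recordK₀ F Mc k + n)) zμ.1, zμ.2⟩ else 0))))) :
    letI θ := thetaFill F a₀ ε₂₉; letI := θ.instVβ₁; letI := θ.instVβ₂; letI := θ.instιβ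
    B12FormatPlus.FormatPlusG
      (fun n => recordDomSys F Mc k (recordK₀ F Mc k + n)) (fun n => recordBondCount F (recordK₀ F Mc k + n))
      (fun n => recordAct F (recordK₀ F Mc k + n)) (fun n => recordUc F Mc k α₀ α₁ (recordK₀ F Mc k + n))
      (fun n => recordCoords F Mc k (recordK₀ F Mc k + n)) (fun n => recordChartDimJ F (recordK₀ F Mc k + n))
      (fun n => recordChartJ F Mc k (recordK₀ F Mc k + n)) Φf
      (fun n => recordEmbJ F θ k (recordK₀ F Mc k + n))
      (fun n => recordWrapCtr F Mc k (recordK₀ F Mc k + n)) (fun n => recordDomEmbCtr F Mc k (recordK₀ F Mc k + n))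
      (fun n _ => recordCoordProjCtr F (recordK₀ F Mc k + n)) E₀ κ := by
  letI θ := thetaFill F a₀ ε₂₉; letI := θ.instVβ₁; letI := θ.instVβ₂; letI := θ.instιβ
  -- the pure pull-back family and its three rows by construction (gen 2)
  have hLΨ : ∀ n, ∀ (X : (recordDomSys F Mc k (recordK₀ F Mc k + n)).Dom) (φ ψ : Sect2.CPair (F.P (recordK₀ F Mc k + n)) (MatA 2)),
      Sect2.agreeOnSet (Sect2.domSites (F.P (recordK₀ F Mc k + n)) Mc (k + 1) X) φ ψ →
      Ψ ((X.1 : Finset _).image (fun c (i : Fin 4) => (c i).valMinAbs))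
          (fun zμ => (φ.1 ⟨cover (F.P (recordK₀ F Mc k + n)) zμ.1, zμ.2⟩, φ.2 ⟨cover (F.P (recordK₀ F Mc k + n)) zμ.1, zμ.2⟩)) =
        Ψ ((X.1 : Finset _).image (fun c (i : Fin 4) => (c i).valMinAbs))
          (fun zμ => (ψ.1 ⟨cover (F.P (recordK₀ F Mc k + n)) zμ.1, zμ.2⟩, ψ.2 ⟨cover (F.P (recordK₀ F Mc k + n)) zμ.1, zμ.2⟩)) :=
    fun n => local17_cpair_of_intLocalFormula hMc (Nat.le_add_right _ _) Ψ hΨloc _ (fun _ _ => rfl)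
  have hGΨ : ∀ n, ∀ (X : (recordDomSys F Mc k (recordK₀ F Mc k + n)).Dom) (u : recordGaugeGrp F (recordK₀ F Mc k + n))
      (φ : Sect2.CPair (F.P (recordK₀ F Mc k + n)) (MatA 2)),
      Ψ ((X.1 : Finset _).image (fun c (i : Fin 4) => (c i).valMinAbs))
          (fun zμ => ((Sect2.cAct u.1 φ).1 ⟨cover (F.P (recordK₀ F Mc k + n)) zμ.1, zμ.2⟩, (Sect2.cAct u.1 φ).2 ⟨cover (F.P (recordK₀ F Mc k + n)) zμ.1, zμ.2⟩)) =
        Ψ ((X.1 : Finset _).image (fun c (i : Fin 4) => (c i).valMinAbs))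
          (fun zμ => (φ.1 ⟨cover (F.P (recordK₀ F Mc k + n)) zμ.1, zμ.2⟩, φ.2 ⟨cover (F.P (recordK₀ F Mc k + n)) zμ.1, zμ.2⟩)) :=
    fun n => gaugeInv119_cpair_of_intLocalFormula (Mc := Mc) (k := k) (K := recordK₀ F Mc k + n) Ψ hΨG _ (fun _ _ => rfl)
  have hVΨ := pieceVolIndep_cpair_of_intLocalFormula Mc k (recordK₀ F Mc k) hMc le_rfl Ψ hΨloc
    (fun n X φ => Ψ ((X.1 : Finset _).image (fun c (i : Fin 4) => (c i).valMinAbs))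
      (fun zμ => (φ.1 ⟨cover (F.P (recordK₀ F Mc k + n)) zμ.1, zμ.2⟩, φ.2 ⟨cover (F.P (recordK₀ F Mc k + n)) zμ.1, zμ.2⟩))) (fun _ _ _ => rfl)
  refine formatPlusG_record_of_cpairRowsCtr F Mc k α₀ α₁ E₀ κ (recordK₀ F Mc k)
    (fun n => recordChartJ F Mc k (recordK₀ F Mc k + n)) Φf (fun n => recordEmbJ F θ k (recordK₀ F Mc k + n))
    (fun n X φ => if X ∈ recordWrapCtr F Mc k (recordK₀ F Mc k + n) then Ew n X φ else
      Ψ ((X.1 : Finset _).image (fun c (i : Fin 4) => (c i).valMinAbs))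
        (fun zμ => (φ.1 ⟨cover (F.P (recordK₀ F Mc k + n)) zμ.1, zμ.2⟩, φ.2 ⟨cover (F.P (recordK₀ F Mc k + n)) zμ.1, zμ.2⟩)))
    (fun n X φ hφ => ?_) (fun n X φ hφ => ?_) (fun n X φ ψ hag => ?_) (fun n X u φ => ?_) (fun n X hX φ' => ?_) (fun n => ?_)
  · -- (a)
    by_cases hX : X ∈ recordWrapCtr F Mc k (recordK₀ F Mc k + n)
    · simp only [if_pos hX]
      exact hEA n X φ hX hφ
    · simp only [if_neg hX]
      exact hA n X φ hX hφ
  · -- (b)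
    by_cases hX : X ∈ recordWrapCtr F Mc k (recordK₀ F Mc k + n)
    · simp only [if_pos hX]
      exact hEB n X φ hX hφ
    · simp only [if_neg hX]
      exact hB n X φ hX hφ
  · -- (c)
    by_cases hX : X ∈ recordWrapCtr F Mc k (recordK₀ F Mc k + n)
    · simp only [if_pos hX]
      exact hEL n X hX φ ψ hag
    · simp only [if_neg hX]
      exact hLΨ n X φ ψ hag
  · -- (d)
    by_cases hX : X ∈ recordWrapCtr F Mc k (recordK₀ F Mc k + n)
    · simp only [if_pos hX]
      exact hEG n X hX u φ
    · simp only [if_neg hX]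
      exact hGΨ n X u φ
  · -- (e): only off the wrap class, where both volumes read the `Ψ` branch
    have hX' : recordDomEmbCtr F Mc k (recordK₀ F Mc k + n) X ∉ recordWrapCtr F Mc k (recordK₀ F Mc k + (n + 1)) :=
      recordDomEmbCtr_not_mem_recordWrapCtr hMc (Nat.le_add_right _ _) X hX
    rw [if_neg hX, if_neg hX']
    exact hVΨ n X hX φ'
  · -- (f) from (f′) + the token
    have h := eventually_repr_recordChartJ_of_pairIdentity_of_analyticAt F θ Mc (succ_le_m_add_K_recordK₀ F Mc k n) (hP9 n) (Φf n)
      (fun X φ => if X ∈ recordWrapCtr F Mc k (recordK₀ F Mc k + n) then Ew n X φ else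
        Ψ ((X.1 : Finset _).image (fun c (i : Fin 4) => (c i).valMinAbs))
          (fun zμ => (φ.1 ⟨cover (F.P (recordK₀ F Mc k + n)) zμ.1, zμ.2⟩, φ.2 ⟨cover (F.P (recordK₀ F Mc k + n)) zμ.1, zμ.2⟩)))
      (by
        filter_upwards [hR n] with B hB'
        rw [hB'])
    exact h

/-! ## §3  ★★★ The signed text from its WRAP-AWARE residue form (the closing road, re-pointed) -/

open scoped Classical in
/-- ★★★ **27930⁸-Ax-LR4 FROM ITS WRAP-AWARE RESIDUE FORM.**  Hypothesis: the signed antecedent (verbatim) ⟹ constants (signed clauses) such that under the signed flow guard there are ONE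
integer formula `Ψ` ((LOC),(GI); rows (a)(b) OFF the wrap class) and torus-level pieces `Ew` (rows (a)(b)(c)(d) ON the wrap class) satisfying the wrap-aware (f′) for
`recordΦfAx … (prefixOf g k)`.  Conclusion: the signed text verbatim (`formatPlusG_recordJ_of_wrapAwareResidue` with `hP9 := TokP9reg`).  Supersedes, as the line's target, the
all-domains residue of `…PortS1Residue` (mis-specified on the wrap class, `…PortS1FlatBlind`). [cite: Balaban1987RG1, Thm 3 p.264, (1.6)–(1.9) p.261, (1.18)–(1.19) p.263, (1.21) p.264] -/
theorem sig27930v8LR4_of_residueW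
    (h : ∀ F : Literature.MathematicalPhysics.QuantumFieldTheory.Balaban1983to89.T4Continuum.T4Family, ∃ Mth : ℕ, ∀ Mc : ℕ, Mth ≤ Mc → ∀ (j c c₀ c₁ : ℕ) (B₃ B₃' a₀ a₁ : ℝ), Summit.QuantumFields.YangMills.Theorems.K0RecordFormatNames.McGuard F Mc → c ≤ F.L ^ j → c₀ ≤ j + 1 → c₁ ≤ j → 2 * (F.L : ℝ) ^ 2 ≤ B₃ → 0 < B₃' → 0 < a₀ → 0 < a₁ → Literature.MathematicalPhysics.QuantumFieldTheory.Balaban1983to89.Node00.VariationalThm1RegSepCoP7MGB F 2 (fun ν M g K k _s => c ≤ ν.M₁ ∧ k + c₀ ≤ F.m + K ∧ F.L ^ c₁ ∣ M ∧ ∀ i, 1 ≤ i → i ≤ k → Literature.MathematicalPhysics.QuantumFieldTheory.Balaban1983to89.Node00.dCubeSide (F.P K).L M (Literature.MathematicalPhysics.QuantumFieldTheory.Balaban1983to89.Node00.RkOfRecord (F.P K).L ν.r (g i)) i ∣ (F.P K).sitesPerDir 0) (Literature.MathematicalPhysics.QuantumFieldTheory.Balaban1983to89.Node00.lamDatum F)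 (Literature.MathematicalPhysics.QuantumFieldTheory.Balaban1983to89.Node00.dataSmall7LamTopOf F 2) B₃ a₀ a₁ → Literature.MathematicalPhysics.QuantumFieldTheory.Balaban1983to89.Node00.Gauge9RegSepTopStepGB F 2 (fun ν K Ω => Literature.MathematicalPhysics.QuantumFieldTheory.Balaban1983to89.Node00.suppDomOfRecord F ν K Ω) (F.L ^ j) (fun ν M g K k _s => c ≤ ν.M₁ ∧ k + c₀ ≤ F.m + K ∧ F.L ^ c₁ ∣ M ∧ ∀ i, 1 ≤ i → i ≤ k → Literature.MathematicalPhysics.QuantumFieldTheory.Balaban1983to89.Node00.dCubeSide (F.P K).L M (Literature.MathematicalPhysics.QuantumFieldTheory.Balaban1983to89.Node00.RkOfRecord (F.P K).L ν.r (g i)) i ∣ (F.P K).sitesPerDir 0) (Literature.MathematicalPhysics.QuantumFieldTheory.Balaban1983to89.Node00.lamDatum F) (Literature.MathematicalPhysics.QuantumFieldTheory.Balaban1983to89.Node00.dataSmall7LamTopOf F 2) B₃ B₃' a₀ a₁ → (∀ ε₁ : ℝ, 0 < ε₁ → ε₁ ≤ a₁ → B₃ * ε₁ ≤ a₀ → ∀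 (k n : ℕ) (V : Literature.MathematicalPhysics.QuantumFieldTheory.Balaban1983to89.GaugeField (F.P (Summit.QuantumFields.YangMills.Theorems.K0RecordFormatNames.recordK₀ F Mc k + n)) (k + 1) (Literature.MathematicalPhysics.QuantumFieldTheory.Balaban1983to89.Node00.SU 2)), Literature.MathematicalPhysics.QuantumFieldTheory.Balaban1983to89.PlaqSmall ε₁ V → Literature.MathematicalPhysics.QuantumFieldTheory.Balaban1983to89.Node00.UkExists F 2 (Summit.QuantumFields.YangMills.Theorems.K0RecordFormatNames.recordK₀ F Mc k + n) (k + 1) a₀ V ∧ Literature.MathematicalPhysics.QuantumFieldTheory.Balaban1983to89.Node00.UniqueUkOrbit F 2 (Summit.QuantumFields.YangMills.Theorems.K0RecordFormatNames.recordK₀ F Mc k + n) (k + 1) a₀ V) → (∀ (k n : ℕ) (ε₂₉ : ℝ), 0 < ε₂₉ → letI θ := Summit.QuantumFields.YangMills.Theorems.K0RecordFormatNames.thetaFill F a₀ ε₂₉; letI := θ.instVβ₁; letI := θ.instVβ₂; letI := θ.instιβ; AnalyticAt ℝ (fun B : Summit.QuantumFields.YangMills.Theorems.K0RecordFormatNames.recordW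 F a₀ ε₂₉ k (Summit.QuantumFields.YangMills.Theorems.K0RecordFormatNames.recordK₀ F Mc k + n) => fun (b : Literature.MathematicalPhysics.QuantumFieldTheory.Balaban1983to89.PBond (F.P (Summit.QuantumFields.YangMills.Theorems.K0RecordFormatNames.recordK₀ F Mc k + n)) 0) (i i' : Fin 2) => ((Summit.QuantumFields.YangMills.Theorems.K0RecordFormatNames.recordBgField F θ k (Summit.QuantumFields.YangMills.Theorems.K0RecordFormatNames.recordK₀ F Mc k + n) B b : Literature.MathematicalPhysics.QuantumFieldTheory.Balaban1983to89.Node00.SU 2) : Matrix (Fin 2) (Fin 2) ℂ) i i') 0) → (∃ C₉' δ₉ : ℝ, 0 ≤ C₉' ∧ 0 < δ₉ ∧ ∀ (k n : ℕ) (ε₂₉ : ℝ), 0 < ε₂₉ → letI θ := Summit.QuantumFields.YangMills.Theorems.K0RecordFormatNames.thetaFill F a₀ ε₂₉; letI := θ.instVβ₁; letI := θ.instVβ₂; letI := θ.instιβ; ∀ (a : θ.ιβ) (μ : Fin (F.P (Summit.QuantumFields.YangMills.Theorems.K0RecordFormatNames.recordK₀ F Mc k + n)).d) (y : Literature.MathematicalPhysics.QuantumFieldTheory.Balaban1983to89.Site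 (F.P (Summit.QuantumFields.YangMills.Theorems.K0RecordFormatNames.recordK₀ F Mc k + n)) (k + 1)), letI D := fderiv ℝ (fun B : Summit.QuantumFields.YangMills.Theorems.K0RecordFormatNames.recordW F a₀ ε₂₉ k (Summit.QuantumFields.YangMills.Theorems.K0RecordFormatNames.recordK₀ F Mc k + n) => fun (b : Literature.MathematicalPhysics.QuantumFieldTheory.Balaban1983to89.PBond (F.P (Summit.QuantumFields.YangMills.Theorems.K0RecordFormatNames.recordK₀ F Mc k + n)) 0) (i i' : Fin 2) => ((Summit.QuantumFields.YangMills.Theorems.K0RecordFormatNames.recordBgField F θ k (Summit.QuantumFields.YangMills.Theorems.K0RecordFormatNames.recordK₀ F Mc k + n) B b : Literature.MathematicalPhysics.QuantumFieldTheory.Balaban1983to89.Node00.SU 2) : Matrix (Fin 2) (Fin 2) ℂ) i i') 0 (Pi.single μ (Pi.single y (θ.bV a))); ∃ (Hr : Literature.MathematicalPhysics.QuantumFieldTheory.Balaban1983to89.PBond (F.P (Summit.QuantumFields.YangMills.Theorems.K0RecordFormatNames.recordK₀ F Mc k + n)) 0 → Fin 2 → Fin 2 → ℂ) (φ : Literature.MathematicalPhysics.QuantumFieldTheory.Balaban1983to89.Site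 (F.P (Summit.QuantumFields.YangMills.Theorems.K0RecordFormatNames.recordK₀ F Mc k + n)) 0 → Fin 2 → Fin 2 → ℂ), (∀ b : Literature.MathematicalPhysics.QuantumFieldTheory.Balaban1983to89.PBond (F.P (Summit.QuantumFields.YangMills.Theorems.K0RecordFormatNames.recordK₀ F Mc k + n)) 0, D b = Hr b + (φ b.src - φ (b.src.shift b.dir))) ∧ (∃ μc : Literature.MathematicalPhysics.QuantumFieldTheory.Balaban1983to89.Site (F.P (Summit.QuantumFields.YangMills.Theorems.K0RecordFormatNames.recordK₀ F Mc k + n)) (k + 1) → Fin 2 → Fin 2 → ℂ, ∀ x : Literature.MathematicalPhysics.QuantumFieldTheory.Balaban1983to89.Site (F.P (Summit.QuantumFields.YangMills.Theorems.K0RecordFormatNames.recordK₀ F Mc k + n)) 0, letI dv := (fun x' : Literature.MathematicalPhysics.QuantumFieldTheory.Balaban1983to89.Site (F.P (Summit.QuantumFields.YangMills.Theorems.K0RecordFormatNames.recordK₀ F Mc k + n)) 0 => ∑ ν : Fin (F.P (Summit.QuantumFields.YangMills.Theorems.K0RecordFormatNames.recordK₀ F Mc k + n)).d, (Hr ⟨x',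 ν⟩ - Hr ⟨x'.unshift ν, ν⟩)); ∑ ν : Fin (F.P (Summit.QuantumFields.YangMills.Theorems.K0RecordFormatNames.recordK₀ F Mc k + n)).d, (dv (x.shift ν) - (2 : ℂ) • dv x + dv (x.unshift ν)) = μc (Summit.QuantumFields.YangMills.Theorems.K0RecordFormatNames.coarsenTo (k + 1) x)) ∧ ∀ b : Literature.MathematicalPhysics.QuantumFieldTheory.Balaban1983to89.PBond (F.P (Summit.QuantumFields.YangMills.Theorems.K0RecordFormatNames.recordK₀ F Mc k + n)) 0, ‖Hr b‖ ≤ C₉' * (F.P (Summit.QuantumFields.YangMills.Theorems.K0RecordFormatNames.recordK₀ F Mc k + n)).eta (k + 1) * Real.exp (-(δ₉ * (Literature.MathematicalPhysics.QuantumFieldTheory.Balaban1983to89.Site.tdist (Summit.QuantumFields.YangMills.Theorems.K0RecordFormatNames.coarsenTo (k + 1) b.src) y : ℝ))) ∧ (∀ ν : Fin (F.P (Summit.QuantumFields.YangMills.Theorems.K0RecordFormatNames.recordK₀ F Mc k + n)).d, ‖Hr (⟨b.src.shift ν, b.dir⟩ : Literature.MathematicalPhysics.QuantumFieldTheory.Balaban1983to89.PBond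 (F.P (Summit.QuantumFields.YangMills.Theorems.K0RecordFormatNames.recordK₀ F Mc k + n)) 0) - Hr b‖ ≤ C₉' * (F.P (Summit.QuantumFields.YangMills.Theorems.K0RecordFormatNames.recordK₀ F Mc k + n)).eta (k + 1) ^ 2 * Real.exp (-(δ₉ * (Literature.MathematicalPhysics.QuantumFieldTheory.Balaban1983to89.Site.tdist (Summit.QuantumFields.YangMills.Theorems.K0RecordFormatNames.coarsenTo (k + 1) b.src) y : ℝ)))) ∧ ‖∑ ν : Fin (F.P (Summit.QuantumFields.YangMills.Theorems.K0RecordFormatNames.recordK₀ F Mc k + n)).d, (Hr (⟨b.src.shift ν, b.dir⟩ : Literature.MathematicalPhysics.QuantumFieldTheory.Balaban1983to89.PBond (F.P (Summit.QuantumFields.YangMills.Theorems.K0RecordFormatNames.recordK₀ F Mc k + n)) 0) - (2 : ℂ) • Hr b + Hr (⟨b.src.unshift ν, b.dir⟩ : Literature.MathematicalPhysics.QuantumFieldTheory.Balaban1983to89.PBond (F.P (Summit.QuantumFields.YangMills.Theorems.K0RecordFormatNames.recordK₀ F Mc k + n)) 0))‖ ≤ C₉' * (F.P (Summit.QuantumFields.YangMills.Theorems.K0RecordFormatNames.recordK₀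 F Mc k + n)).eta (k + 1) ^ 3 * Real.exp (-(δ₉ * (Literature.MathematicalPhysics.QuantumFieldTheory.Balaban1983to89.Site.tdist (Summit.QuantumFields.YangMills.Theorems.K0RecordFormatNames.coarsenTo (k + 1) b.src) y : ℝ))) ∧ ‖∑ ν : Fin (F.P (Summit.QuantumFields.YangMills.Theorems.K0RecordFormatNames.recordK₀ F Mc k + n)).d, ((Hr (⟨b.src, b.dir⟩ : Literature.MathematicalPhysics.QuantumFieldTheory.Balaban1983to89.PBond (F.P (Summit.QuantumFields.YangMills.Theorems.K0RecordFormatNames.recordK₀ F Mc k + n)) 0) + Hr (⟨(b.src).shift b.dir, ν⟩ : Literature.MathematicalPhysics.QuantumFieldTheory.Balaban1983to89.PBond (F.P (Summit.QuantumFields.YangMills.Theorems.K0RecordFormatNames.recordK₀ F Mc k + n)) 0) - Hr (⟨(b.src).shift ν, b.dir⟩ : Literature.MathematicalPhysics.QuantumFieldTheory.Balaban1983to89.PBond (F.P (Summit.QuantumFields.YangMills.Theorems.K0RecordFormatNames.recordK₀ F Mc k + n)) 0) - Hr (⟨b.src, ν⟩ : Literature.MathematicalPhysics.QuantumFieldTheory.Balaban1983to89.PBond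 (F.P (Summit.QuantumFields.YangMills.Theorems.K0RecordFormatNames.recordK₀ F Mc k + n)) 0)) - (Hr (⟨b.src.unshift ν, b.dir⟩ : Literature.MathematicalPhysics.QuantumFieldTheory.Balaban1983to89.PBond (F.P (Summit.QuantumFields.YangMills.Theorems.K0RecordFormatNames.recordK₀ F Mc k + n)) 0) + Hr (⟨(b.src.unshift ν).shift b.dir, ν⟩ : Literature.MathematicalPhysics.QuantumFieldTheory.Balaban1983to89.PBond (F.P (Summit.QuantumFields.YangMills.Theorems.K0RecordFormatNames.recordK₀ F Mc k + n)) 0) - Hr (⟨(b.src.unshift ν).shift ν, b.dir⟩ : Literature.MathematicalPhysics.QuantumFieldTheory.Balaban1983to89.PBond (F.P (Summit.QuantumFields.YangMills.Theorems.K0RecordFormatNames.recordK₀ F Mc k + n)) 0) - Hr (⟨b.src.unshift ν, ν⟩ : Literature.MathematicalPhysics.QuantumFieldTheory.Balaban1983to89.PBond (F.P (Summit.QuantumFields.YangMills.Theorems.K0RecordFormatNames.recordK₀ F Mc k + n)) 0)))‖ ≤ C₉' * (F.P (Summit.QuantumFields.YangMills.Theorems.K0RecordFormatNames.recordK₀ F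 Mc k + n)).eta (k + 1) ^ 3 * Real.exp (-(δ₉ * (Literature.MathematicalPhysics.QuantumFieldTheory.Balaban1983to89.Site.tdist (Summit.QuantumFields.YangMills.Theorems.K0RecordFormatNames.coarsenTo (k + 1) b.src) y : ℝ)))) → ∃ γ₀ ε₂₉ E₀ κ α₀ α₁ : ℝ, 0 < γ₀ ∧ 0 < ε₂₉ ∧ 0 ≤ E₀ ∧ 4 * Literature.MathematicalPhysics.QuantumFieldTheory.Balaban1983to89.B12TreeDecay.kappa₀ (4 * 2 ^ 4) (2 * 4) ≤ κ ∧ 0 < α₀ ∧ 0 < α₁ ∧ ∀ k : ℕ, ∀ g : ℕ → ℝ, Literature.MathematicalPhysics.QuantumFieldTheory.Balaban1983to89.FlowStep.RGEqH k (Literature.MathematicalPhysics.QuantumFieldTheory.Balaban1983to89.Node00.betaOfRecord₁₃Ax F 2 (Summit.QuantumFields.YangMills.Theorems.K0RecordFormatNames.thetaFill F a₀ ε₂₉)) g → Literature.MathematicalPhysics.QuantumFieldTheory.Balaban1983to89.Step.InInterval γ₀ k g → 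
      letI θ := Summit.QuantumFields.YangMills.Theorems.K0RecordFormatNames.thetaFill F a₀ ε₂₉; letI := θ.instVβ₁; letI := θ.instVβ₂; letI := θ.instιβ; ∃ Ψ : Finset (Fin 4 → ℤ) → (((Fin 4 → ℤ) × Fin 4) → MatA 2 × MatA 2) → ℂ,
          (∀ (Xh : Finset (Fin 4 → ℤ)) (f f' : ((Fin 4 → ℤ) × Fin 4) → MatA 2 × MatA 2),
            (∀ zμ : (Fin 4 → ℤ) × Fin 4, zμ.1 ∈ (⋃ a ∈ Xh, cubeExt (F.L ^ (k + 1) * Mc) a 0) →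
              Function.update zμ.1 zμ.2 (zμ.1 zμ.2 + 1) ∈ (⋃ a ∈ Xh, cubeExt (F.L ^ (k + 1) * Mc) a 0) → f zμ = f' zμ) → Ψ Xh f = Ψ Xh f') ∧
          (∀ (Xh : Finset (Fin 4 → ℤ)) (û : (Fin 4 → ℤ) → (MatA 2)ˣ), (∀ z, û z ∈ (B12RegularSpaces111SpecialUnitary.suModel 2).Gc) →
            ∀ f : ((Fin 4 → ℤ) × Fin 4) → MatA 2 × MatA 2,
              Ψ Xh (fun zμ => ((û zμ.1 : MatA 2) * (f zμ).1 * ((û (Function.update zμ.1 zμ.2 (zμ.1 zμ.2 + 1)))⁻¹ : (MatA 2)ˣ),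
                (û zμ.1 : MatA 2) * (f zμ).2 * ((û zμ.1)⁻¹ : (MatA 2)ˣ))) = Ψ Xh f) ∧
          ∃ Ew : (n : ℕ) → (recordDomSys F Mc k (recordK₀ F Mc k + n)).Dom → Sect2.CPair (F.P (recordK₀ F Mc k + n)) (MatA 2) → ℂ,
          (∀ n (X : (recordDomSys F Mc k (recordK₀ F Mc k + n)).Dom) (φ : Sect2.CPair (F.P (recordK₀ F Mc k + n)) (MatA 2)),
            X ∉ recordWrapCtr F Mc k (recordK₀ F Mc k + n) → encodeCfg F (recordK₀ F Mc k + n) φ ∈ recordUc F Mc k α₀ α₁ (recordK₀ F Mc k + n) X →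
              AnalyticAt ℂ (fun ψ : Sect2.CPair (F.P (recordK₀ F Mc k + n)) (MatA 2) =>
                Ψ ((X.1 : Finset _).image (fun c (i : Fin 4) => (c i).valMinAbs))
                  (fun zμ => (ψ.1 ⟨cover (F.P (recordK₀ F Mc k + n)) zμ.1, zμ.2⟩, ψ.2 ⟨cover (F.P (recordK₀ F Mc k + n)) zμ.1, zμ.2⟩))) φ) ∧
          (∀ n (X : (recordDomSys F Mc k (recordK₀ F Mc k + n)).Dom) (φ : Sect2.CPair (F.P (recordK₀ F Mc k + n)) (MatA 2)),
            X ∉ recordWrapCtr F Mc k (recordK₀ F Mc k + n) → encodeCfg F (recordK₀ F Mc k + n) φ ∈ recordUc F Mc k α₀ α₁ (recordK₀ F Mc k + n) X →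
              ‖Ψ ((X.1 : Finset _).image (fun c (i : Fin 4) => (c i).valMinAbs))
                  (fun zμ => (φ.1 ⟨cover (F.P (recordK₀ F Mc k + n)) zμ.1, zμ.2⟩, φ.2 ⟨cover (F.P (recordK₀ F Mc k + n)) zμ.1, zμ.2⟩))‖ ≤
                E₀ * Real.exp (-κ * (recordDomSys F Mc k (recordK₀ F Mc k + n)).dj X)) ∧
          (∀ n (X : (recordDomSys F Mc k (recordK₀ F Mc k + n)).Dom) (φ : Sect2.CPair (F.P (recordK₀ F Mc k + n)) (MatA 2)),
            X ∈ recordWrapCtr F Mc k (recordK₀ F Mc k + n) → encodeCfg F (recordK₀ F Mc k + n) φ ∈ recordUc F Mc k α₀ α₁ (recordK₀ F Mc k + n) X → AnalyticAt ℂ (Ew n X) φ) ∧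
          (∀ n (X : (recordDomSys F Mc k (recordK₀ F Mc k + n)).Dom) (φ : Sect2.CPair (F.P (recordK₀ F Mc k + n)) (MatA 2)),
            X ∈ recordWrapCtr F Mc k (recordK₀ F Mc k + n) → encodeCfg F (recordK₀ F Mc k + n) φ ∈ recordUc F Mc k α₀ α₁ (recordK₀ F Mc k + n) X →
              ‖Ew n X φ‖ ≤ E₀ * Real.exp (-κ * (recordDomSys F Mc k (recordK₀ F Mc k + n)).dj X)) ∧
          (∀ n (X : (recordDomSys F Mc k (recordK₀ F Mc k + n)).Dom), X ∈ recordWrapCtr F Mc k (recordK₀ F Mc k + n) →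
            ∀ φ ψ, Sect2.agreeOnSet (Sect2.domSites (F.P (recordK₀ F Mc k + n)) Mc (k + 1) X) φ ψ → Ew n X φ = Ew n X ψ) ∧
          (∀ n (X : (recordDomSys F Mc k (recordK₀ F Mc k + n)).Dom), X ∈ recordWrapCtr F Mc k (recordK₀ F Mc k + n) →
            ∀ (u : recordGaugeGrp F (recordK₀ F Mc k + n)) φ, Ew n X (Sect2.cAct u.1 φ) = Ew n X φ) ∧
          (∀ n, ∀ᶠ B in 𝓝 (0 : recordW F a₀ ε₂₉ k (recordK₀ F Mc k + n)),
            recordΦfAx F a₀ ε₂₉ k (FlowStep.prefixOf g k) (recordK₀ F Mc k + n) B =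
              ∑ X : (recordDomSys F Mc k (recordK₀ F Mc k + n)).Dom,
                (if X ∈ recordWrapCtr F Mc k (recordK₀ F Mc k + n) then
                  Ew n X (fun b => if b ∈ domBonds F Mc k (recordK₀ F Mc k + n) X then ((recordBgField F θ k (recordK₀ F Mc k + n) B b : SU 2) : MatA 2) else 1,
                          fun b => if b ∈ domBonds F Mc k (recordK₀ F Mc k + n) X then recordCurrent F θ k (recordK₀ F Mc k + n) B b else 0)
                else
                  Ψ ((X.1 : Finset _).image (fun c (i : Fin 4) => (c i).valMinAbs))
                    (fun zμ =>
                      ((if (⟨cover (F.P (recordK₀ F Mc k + n)) zμ.1, zμ.2⟩ : PBond (F.P (recordK₀ F Mc k + n)) 0) ∈ domBonds F Mc k (recordK₀ F Mc k + n) X then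
                          ((recordBgField F θ k (recordK₀ F Mc k + n) B ⟨cover (F.P (recordK₀ F Mc k + n)) zμ.1, zμ.2⟩ : SU 2) : MatA 2) else 1),
                       (if (⟨cover (F.P (recordK₀ F Mc k + n)) zμ.1, zμ.2⟩ : PBond (F.P (recordK₀ F Mc k + n)) 0) ∈ domBonds F Mc k (recordK₀ F Mc k + n) X then
                          recordCurrent F θ k (recordK₀ F Mc k + n) B ⟨cover (F.P (recordK₀ F Mc k + n)) zμ.1, zμ.2⟩ else 0)))))) :
    ∀ F : Literature.MathematicalPhysics.QuantumFieldTheory.Balaban1983to89.T4Continuum.T4Family, ∃ Mth : ℕ, ∀ Mc : ℕ, Mth ≤ Mc → ∀ (j c c₀ c₁ : ℕ) (B₃ B₃' a₀ a₁ : ℝ), Summit.QuantumFields.YangMills.Theorems.K0RecordFormatNames.McGuard F Mc → c ≤ F.L ^ j → c₀ ≤ j + 1 → c₁ ≤ j → 2 * (F.L : ℝ) ^ 2 ≤ B₃ → 0 < B₃' → 0 < a₀ → 0 < a₁ → Literature.MathematicalPhysics.QuantumFieldTheory.Balaban1983to89.Node00.VariationalThm1RegSepCoP7MGB F 2 (fun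 ν M g K k _s => c ≤ ν.M₁ ∧ k + c₀ ≤ F.m + K ∧ F.L ^ c₁ ∣ M ∧ ∀ i, 1 ≤ i → i ≤ k → Literature.MathematicalPhysics.QuantumFieldTheory.Balaban1983to89.Node00.dCubeSide (F.P K).L M (Literature.MathematicalPhysics.QuantumFieldTheory.Balaban1983to89.Node00.RkOfRecord (F.P K).L ν.r (g i)) i ∣ (F.P K).sitesPerDir 0) (Literature.MathematicalPhysics.QuantumFieldTheory.Balaban1983to89.Node00.lamDatum F) (Literature.MathematicalPhysics.QuantumFieldTheory.Balaban1983to89.Node00.dataSmall7LamTopOf F 2) B₃ a₀ a₁ → Literature.MathematicalPhysics.QuantumFieldTheory.Balaban1983to89.Node00.Gauge9RegSepTopStepGB F 2 (fun ν K Ω => Literature.MathematicalPhysics.QuantumFieldTheory.Balaban1983to89.Node00.suppDomOfRecord F ν K Ω) (F.L ^ j) (fun ν M g K k _s => c ≤ ν.M₁ ∧ k + c₀ ≤ F.m + K ∧ F.L ^ c₁ ∣ M ∧ ∀ i, 1 ≤ i → i ≤ k → Literature.MathematicalPhysics.QuantumFieldTheory.Balaban1983to89.Node00.dCubeSide (F.P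 K).L M (Literature.MathematicalPhysics.QuantumFieldTheory.Balaban1983to89.Node00.RkOfRecord (F.P K).L ν.r (g i)) i ∣ (F.P K).sitesPerDir 0) (Literature.MathematicalPhysics.QuantumFieldTheory.Balaban1983to89.Node00.lamDatum F) (Literature.MathematicalPhysics.QuantumFieldTheory.Balaban1983to89.Node00.dataSmall7LamTopOf F 2) B₃ B₃' a₀ a₁ → (∀ ε₁ : ℝ, 0 < ε₁ → ε₁ ≤ a₁ → B₃ * ε₁ ≤ a₀ → ∀ (k n : ℕ) (V : Literature.MathematicalPhysics.QuantumFieldTheory.Balaban1983to89.GaugeField (F.P (Summit.QuantumFields.YangMills.Theorems.K0RecordFormatNames.recordK₀ F Mc k + n)) (k + 1) (Literature.MathematicalPhysics.QuantumFieldTheory.Balaban1983to89.Node00.SU 2)), Literature.MathematicalPhysics.QuantumFieldTheory.Balaban1983to89.PlaqSmall ε₁ V → Literature.MathematicalPhysics.QuantumFieldTheory.Balaban1983to89.Node00.UkExists F 2 (Summit.QuantumFields.YangMills.Theorems.K0RecordFormatNames.recordK₀ F Mc k + n) (k + 1) a₀ V ∧ Literature.MathematicalPhysics.QuantumFieldTheory.Balaban1983to89.Node00.UniqueUkOrbit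 F 2 (Summit.QuantumFields.YangMills.Theorems.K0RecordFormatNames.recordK₀ F Mc k + n) (k + 1) a₀ V) → (∀ (k n : ℕ) (ε₂₉ : ℝ), 0 < ε₂₉ → letI θ := Summit.QuantumFields.YangMills.Theorems.K0RecordFormatNames.thetaFill F a₀ ε₂₉; letI := θ.instVβ₁; letI := θ.instVβ₂; letI := θ.instιβ; AnalyticAt ℝ (fun B : Summit.QuantumFields.YangMills.Theorems.K0RecordFormatNames.recordW F a₀ ε₂₉ k (Summit.QuantumFields.YangMills.Theorems.K0RecordFormatNames.recordK₀ F Mc k + n) => fun (b : Literature.MathematicalPhysics.QuantumFieldTheory.Balaban1983to89.PBond (F.P (Summit.QuantumFields.YangMills.Theorems.K0RecordFormatNames.recordK₀ F Mc k + n)) 0) (i i' : Fin 2) => ((Summit.QuantumFields.YangMills.Theorems.K0RecordFormatNames.recordBgField F θ k (Summit.QuantumFields.YangMills.Theorems.K0RecordFormatNames.recordK₀ F Mc k + n) B b : Literature.MathematicalPhysics.QuantumFieldTheory.Balaban1983to89.Node00.SU 2) : Matrix (Fin 2) (Fin 2) ℂ) i i') 0) → (∃ C₉' δ₉ : ℝ,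 0 ≤ C₉' ∧ 0 < δ₉ ∧ ∀ (k n : ℕ) (ε₂₉ : ℝ), 0 < ε₂₉ → letI θ := Summit.QuantumFields.YangMills.Theorems.K0RecordFormatNames.thetaFill F a₀ ε₂₉; letI := θ.instVβ₁; letI := θ.instVβ₂; letI := θ.instιβ; ∀ (a : θ.ιβ) (μ : Fin (F.P (Summit.QuantumFields.YangMills.Theorems.K0RecordFormatNames.recordK₀ F Mc k + n)).d) (y : Literature.MathematicalPhysics.QuantumFieldTheory.Balaban1983to89.Site (F.P (Summit.QuantumFields.YangMills.Theorems.K0RecordFormatNames.recordK₀ F Mc k + n)) (k + 1)), letI D := fderiv ℝ (fun B : Summit.QuantumFields.YangMills.Theorems.K0RecordFormatNames.recordW F a₀ ε₂₉ k (Summit.QuantumFields.YangMills.Theorems.K0RecordFormatNames.recordK₀ F Mc k + n) => fun (b : Literature.MathematicalPhysics.QuantumFieldTheory.Balaban1983to89.PBond (F.P (Summit.QuantumFields.YangMills.Theorems.K0RecordFormatNames.recordK₀ F Mc k + n)) 0) (i i' : Fin 2) => ((Summit.QuantumFields.YangMills.Theorems.K0RecordFormatNames.recordBgField F θ k (Summit.QuantumFields.YangMills.Theorems.K0RecordFormatNames.recordK₀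 F Mc k + n) B b : Literature.MathematicalPhysics.QuantumFieldTheory.Balaban1983to89.Node00.SU 2) : Matrix (Fin 2) (Fin 2) ℂ) i i') 0 (Pi.single μ (Pi.single y (θ.bV a))); ∃ (Hr : Literature.MathematicalPhysics.QuantumFieldTheory.Balaban1983to89.PBond (F.P (Summit.QuantumFields.YangMills.Theorems.K0RecordFormatNames.recordK₀ F Mc k + n)) 0 → Fin 2 → Fin 2 → ℂ) (φ : Literature.MathematicalPhysics.QuantumFieldTheory.Balaban1983to89.Site (F.P (Summit.QuantumFields.YangMills.Theorems.K0RecordFormatNames.recordK₀ F Mc k + n)) 0 → Fin 2 → Fin 2 → ℂ), (∀ b : Literature.MathematicalPhysics.QuantumFieldTheory.Balaban1983to89.PBond (F.P (Summit.QuantumFields.YangMills.Theorems.K0RecordFormatNames.recordK₀ F Mc k + n)) 0, D b = Hr b + (φ b.src - φ (b.src.shift b.dir))) ∧ (∃ μc : Literature.MathematicalPhysics.QuantumFieldTheory.Balaban1983to89.Site (F.P (Summit.QuantumFields.YangMills.Theorems.K0RecordFormatNames.recordK₀ F Mc k + n)) (k + 1) → Fin 2 → Fin 2 → ℂ, ∀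 x : Literature.MathematicalPhysics.QuantumFieldTheory.Balaban1983to89.Site (F.P (Summit.QuantumFields.YangMills.Theorems.K0RecordFormatNames.recordK₀ F Mc k + n)) 0, letI dv := (fun x' : Literature.MathematicalPhysics.QuantumFieldTheory.Balaban1983to89.Site (F.P (Summit.QuantumFields.YangMills.Theorems.K0RecordFormatNames.recordK₀ F Mc k + n)) 0 => ∑ ν : Fin (F.P (Summit.QuantumFields.YangMills.Theorems.K0RecordFormatNames.recordK₀ F Mc k + n)).d, (Hr ⟨x', ν⟩ - Hr ⟨x'.unshift ν, ν⟩)); ∑ ν : Fin (F.P (Summit.QuantumFields.YangMills.Theorems.K0RecordFormatNames.recordK₀ F Mc k + n)).d, (dv (x.shift ν) - (2 : ℂ) • dv x + dv (x.unshift ν)) = μc (Summit.QuantumFields.YangMills.Theorems.K0RecordFormatNames.coarsenTo (k + 1) x)) ∧ ∀ b : Literature.MathematicalPhysics.QuantumFieldTheory.Balaban1983to89.PBond (F.P (Summit.QuantumFields.YangMills.Theorems.K0RecordFormatNames.recordK₀ F Mc k + n)) 0, ‖Hr b‖ ≤ C₉' * (F.P (Summit.QuantumFields.YangMills.Theorems.K0RecordFormatNames.recordK₀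 F Mc k + n)).eta (k + 1) * Real.exp (-(δ₉ * (Literature.MathematicalPhysics.QuantumFieldTheory.Balaban1983to89.Site.tdist (Summit.QuantumFields.YangMills.Theorems.K0RecordFormatNames.coarsenTo (k + 1) b.src) y : ℝ))) ∧ (∀ ν : Fin (F.P (Summit.QuantumFields.YangMills.Theorems.K0RecordFormatNames.recordK₀ F Mc k + n)).d, ‖Hr (⟨b.src.shift ν, b.dir⟩ : Literature.MathematicalPhysics.QuantumFieldTheory.Balaban1983to89.PBond (F.P (Summit.QuantumFields.YangMills.Theorems.K0RecordFormatNames.recordK₀ F Mc k + n)) 0) - Hr b‖ ≤ C₉' * (F.P (Summit.QuantumFields.YangMills.Theorems.K0RecordFormatNames.recordK₀ F Mc k + n)).eta (k + 1) ^ 2 * Real.exp (-(δ₉ * (Literature.MathematicalPhysics.QuantumFieldTheory.Balaban1983to89.Site.tdist (Summit.QuantumFields.YangMills.Theorems.K0RecordFormatNames.coarsenTo (k + 1) b.src) y : ℝ)))) ∧ ‖∑ ν : Fin (F.P (Summit.QuantumFields.YangMills.Theorems.K0RecordFormatNames.recordK₀ F Mc k + n)).d, (Hr (⟨b.src.shift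 ν, b.dir⟩ : Literature.MathematicalPhysics.QuantumFieldTheory.Balaban1983to89.PBond (F.P (Summit.QuantumFields.YangMills.Theorems.K0RecordFormatNames.recordK₀ F Mc k + n)) 0) - (2 : ℂ) • Hr b + Hr (⟨b.src.unshift ν, b.dir⟩ : Literature.MathematicalPhysics.QuantumFieldTheory.Balaban1983to89.PBond (F.P (Summit.QuantumFields.YangMills.Theorems.K0RecordFormatNames.recordK₀ F Mc k + n)) 0))‖ ≤ C₉' * (F.P (Summit.QuantumFields.YangMills.Theorems.K0RecordFormatNames.recordK₀ F Mc k + n)).eta (k + 1) ^ 3 * Real.exp (-(δ₉ * (Literature.MathematicalPhysics.QuantumFieldTheory.Balaban1983to89.Site.tdist (Summit.QuantumFields.YangMills.Theorems.K0RecordFormatNames.coarsenTo (k + 1) b.src) y : ℝ))) ∧ ‖∑ ν : Fin (F.P (Summit.QuantumFields.YangMills.Theorems.K0RecordFormatNames.recordK₀ F Mc k + n)).d, ((Hr (⟨b.src, b.dir⟩ : Literature.MathematicalPhysics.QuantumFieldTheory.Balaban1983to89.PBond (F.P (Summit.QuantumFields.YangMills.Theorems.K0RecordFormatNames.recordK₀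 F Mc k + n)) 0) + Hr (⟨(b.src).shift b.dir, ν⟩ : Literature.MathematicalPhysics.QuantumFieldTheory.Balaban1983to89.PBond (F.P (Summit.QuantumFields.YangMills.Theorems.K0RecordFormatNames.recordK₀ F Mc k + n)) 0) - Hr (⟨(b.src).shift ν, b.dir⟩ : Literature.MathematicalPhysics.QuantumFieldTheory.Balaban1983to89.PBond (F.P (Summit.QuantumFields.YangMills.Theorems.K0RecordFormatNames.recordK₀ F Mc k + n)) 0) - Hr (⟨b.src, ν⟩ : Literature.MathematicalPhysics.QuantumFieldTheory.Balaban1983to89.PBond (F.P (Summit.QuantumFields.YangMills.Theorems.K0RecordFormatNames.recordK₀ F Mc k + n)) 0)) - (Hr (⟨b.src.unshift ν, b.dir⟩ : Literature.MathematicalPhysics.QuantumFieldTheory.Balaban1983to89.PBond (F.P (Summit.QuantumFields.YangMills.Theorems.K0RecordFormatNames.recordK₀ F Mc k + n)) 0) + Hr (⟨(b.src.unshift ν).shift b.dir, ν⟩ : Literature.MathematicalPhysics.QuantumFieldTheory.Balaban1983to89.PBond (F.P (Summit.QuantumFields.YangMills.Theorems.K0RecordFormatNames.recordK₀ F Mc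 k + n)) 0) - Hr (⟨(b.src.unshift ν).shift ν, b.dir⟩ : Literature.MathematicalPhysics.QuantumFieldTheory.Balaban1983to89.PBond (F.P (Summit.QuantumFields.YangMills.Theorems.K0RecordFormatNames.recordK₀ F Mc k + n)) 0) - Hr (⟨b.src.unshift ν, ν⟩ : Literature.MathematicalPhysics.QuantumFieldTheory.Balaban1983to89.PBond (F.P (Summit.QuantumFields.YangMills.Theorems.K0RecordFormatNames.recordK₀ F Mc k + n)) 0)))‖ ≤ C₉' * (F.P (Summit.QuantumFields.YangMills.Theorems.K0RecordFormatNames.recordK₀ F Mc k + n)).eta (k + 1) ^ 3 * Real.exp (-(δ₉ * (Literature.MathematicalPhysics.QuantumFieldTheory.Balaban1983to89.Site.tdist (Summit.QuantumFields.YangMills.Theorems.K0RecordFormatNames.coarsenTo (k + 1) b.src) y : ℝ)))) → ∃ γ₀ ε₂₉ E₀ κ α₀ α₁ : ℝ, 0 < γ₀ ∧ 0 < ε₂₉ ∧ 0 ≤ E₀ ∧ 4 * Literature.MathematicalPhysics.QuantumFieldTheory.Balaban1983to89.B12TreeDecay.kappa₀ (4 * 2 ^ 4) (2 * 4) ≤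 κ ∧ 0 < α₀ ∧ 0 < α₁ ∧ ∀ k : ℕ, ∀ g : ℕ → ℝ, Literature.MathematicalPhysics.QuantumFieldTheory.Balaban1983to89.FlowStep.RGEqH k (Literature.MathematicalPhysics.QuantumFieldTheory.Balaban1983to89.Node00.betaOfRecord₁₃Ax F 2 (Summit.QuantumFields.YangMills.Theorems.K0RecordFormatNames.thetaFill F a₀ ε₂₉)) g → Literature.MathematicalPhysics.QuantumFieldTheory.Balaban1983to89.Step.InInterval γ₀ k g → letI θ := Summit.QuantumFields.YangMills.Theorems.K0RecordFormatNames.thetaFill F a₀ ε₂₉; letI := θ.instVβ₁; letI := θ.instVβ₂; letI := θ.instιβ; Literature.MathematicalPhysics.QuantumFieldTheory.Balaban1983to89.B12FormatPlus.FormatPlusG (fun n => Summit.QuantumFields.YangMills.Theorems.K0RecordFormatNames.recordDomSys F Mc k (Summit.QuantumFields.YangMills.Theorems.K0RecordFormatNames.recordK₀ F Mc k + n)) (fun n => Summit.QuantumFields.YangMills.Theorems.K0RecordFormatNames.recordBondCount F (Summit.QuantumFields.YangMills.Theorems.K0RecordFormatNames.recordK₀ F Mc k + n)) (fun n => Summit.QuantumFields.YangMills.Theorems.K0RecordFormatNames.recordAct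 F (Summit.QuantumFields.YangMills.Theorems.K0RecordFormatNames.recordK₀ F Mc k + n)) (fun n => Summit.QuantumFields.YangMills.Theorems.K0RecordFormatNames.recordUc F Mc k α₀ α₁ (Summit.QuantumFields.YangMills.Theorems.K0RecordFormatNames.recordK₀ F Mc k + n)) (fun n => Summit.QuantumFields.YangMills.Theorems.K0RecordFormatNames.recordCoords F Mc k (Summit.QuantumFields.YangMills.Theorems.K0RecordFormatNames.recordK₀ F Mc k + n)) (fun n => Summit.QuantumFields.YangMills.Theorems.K0RecordFormatNames.recordChartDimJ F (Summit.QuantumFields.YangMills.Theorems.K0RecordFormatNames.recordK₀ F Mc k + n)) (fun n => Summit.QuantumFields.YangMills.Theorems.K0RecordFormatNames.recordChartJ F Mc k (Summit.QuantumFields.YangMills.Theorems.K0RecordFormatNames.recordK₀ F Mc k + n)) (fun n => Summit.QuantumFields.YangMills.Theorems.K0RecordFormatNames.recordΦfAx F a₀ ε₂₉ k (Literature.MathematicalPhysics.QuantumFieldTheory.Balaban1983to89.FlowStep.prefixOf g k) (Summit.QuantumFields.YangMills.Theorems.K0RecordFormatNames.recordK₀ F Mc k + n)) (fun n => Summit.QuantumFields.YangMills.Theorems.K0RecordFormatNames.recordEmbJ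 F θ k (Summit.QuantumFields.YangMills.Theorems.K0RecordFormatNames.recordK₀ F Mc k + n)) (fun n => Summit.QuantumFields.YangMills.Theorems.K0RecordFormatNames.recordWrapCtr F Mc k (Summit.QuantumFields.YangMills.Theorems.K0RecordFormatNames.recordK₀ F Mc k + n)) (fun n => Summit.QuantumFields.YangMills.Theorems.K0RecordFormatNames.recordDomEmbCtr F Mc k (Summit.QuantumFields.YangMills.Theorems.K0RecordFormatNames.recordK₀ F Mc k + n)) (fun n _ => Summit.QuantumFields.YangMills.Theorems.K0RecordFormatNames.recordCoordProjCtr F (Summit.QuantumFields.YangMills.Theorems.K0RecordFormatNames.recordK₀ F Mc k + n)) E₀ κ := by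
  intro F
  obtain ⟨Mth, hM⟩ := h F
  refine ⟨Mth, fun Mc hMc j c c₀ c₁ B₃ B₃' a₀ a₁ hG h₁ h₂ h₃ h₄ h₅ h₆ h₇ hT8 hT9 hTE hP9 hP9L => ?_⟩
  obtain ⟨γ₀, ε₂₉, E₀, κ, α₀, α₁, hγ, hε, hE, hκ, hα₀, hα₁, hres⟩ :=
    hM Mc hMc j c c₀ c₁ B₃ B₃' a₀ a₁ hG h₁ h₂ h₃ h₄ h₅ h₆ h₇ hT8 hT9 hTE hP9 hP9L
  refine ⟨γ₀, ε₂₉, E₀, κ, α₀, α₁, hγ, hε, hE, hκ, hα₀, hα₁, fun k g hflow hint => ?_⟩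
  obtain ⟨Ψ, hΨloc, hΨG, Ew, hA, hB, hEA, hEB, hEL, hEG, hR⟩ := hres k g hflow hint
  exact formatPlusG_recordJ_of_wrapAwareResidue F Mc k hG a₀ ε₂₉ α₀ α₁ E₀ κ
    (fun n => recordΦfAx F a₀ ε₂₉ k (FlowStep.prefixOf g k) (recordK₀ F Mc k + n))
    (fun n => hP9 k n ε₂₉ hε) Ψ hΨloc hΨG Ew hA hB hEA hEB hEL hEG hR

end Summit.QuantumFields.YangMills.Theorems.BalabanUVNodesPortS1

end
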